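import Mathlib
import Summits.Ventures.PercRepro2.TypedPendantPair
import Summits.Ventures.PercRepro2.TypedContract
import Summits.Ventures.PercRepro2.TypedResidualBase
import Summits.Ventures.PercRepro2.TypedSupportRestrict

/-!
# A new reducible class of row 2′TRI: the pendant `o·b` pair (blind cell PercRepro2, mine-2 g52,
2026-08-29; `conjectures/MINE-2.md` M2-109 add. 1)

The pendant-pair rule (`TypedPendantPair.lean`) reduces the typed count of `K₃` at a class-`1`
leaf carrying both `o` and `b` to the typed count of the same-slot part `KP`, and on the pair
states `KP = 2 · pd(x) · q(y) · q(z) · [the pair and `a₃` on opposite sides in `z`]` — a product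
of indicators, hence POINTWISE nonnegative (`KP_nonneg_pair`, the consistency of the states of a
configuration being `Conn`-transitivity).  So row 2′TRI holds on every such instance with no
hypothesis on the rest of the graph: **`typedCount_nonneg_of_pendant_pair_one`** (`o = b` a leaf at
a class-`1` edge) and, for the instances of the census, **`typedCount_nonneg_of_pendant_o_b`**
(`o` a leaf at `b` by an edge of class `≥ 1`, `b` carrying one further edge, of class `1`; the
reduction by night-3's leaf rule for `o`, the contraction of the pinned-open `o–b` edge, the
closing of the loop and the restriction to the support).  Own work; standard axioms.
-/

namespace Summit.Ventures.PercRepro2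

namespace CovForm

namespace TypedRed

open OneTyped Contract Restrict

/-! ## The same-slot part is nonnegative on the states of a configuration -/

section Pointwise

/-- `pdB ≥ 0`. -/
lemma pdB_nonneg (s : St) : (0 : ℤ) ≤ pdB s := by
  unfold pdB; split_ifs <;> norm_num

/-- `qB ≥ 0`. -/
lemma qB_nonneg (s : St) : (0 : ℤ) ≤ qB s := by
  unfold qB; split_ifs <;> norm_num

/-- **`KP ≥ 0` on consistent pair states.** -/
lemma KP_nonneg_pair (x y z : St) (h1 : z.Lo = z.Lb) (h2 : z.Ho = z.Hb)
    (h3 : z.Lo = true → z.Ho = true → z.q' = true) (h4 : z.L3 = true → z.H3 = true → z.q' = true) :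
    0 ≤ KP x y z := by
  rw [KP_pair x y z h1 h2 h3 h4]
  have hind : (0 : ℤ) ≤ (if (z.Lo && z.H3) || (z.Ho && z.L3) then 1 else 0) := by
    split_ifs <;> norm_num
  exact mul_nonneg (by norm_num) (mul_nonneg (pdB_nonneg x) (mul_nonneg (qB_nonneg y)
    (mul_nonneg (qB_nonneg z) hind)))

variable {V : Type*} {E : Type*}
variable (ends : E → Sym2 V) (a₁ a₂ a₃ w : V)

open Classical in
/-- With `o = b = w` the two `o`-coordinates are the two `b`-coordinates. -/
lemma st_pair_Lo_eq_Lb (ω : Config E) :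
    (st ends w a₁ a₂ a₃ w ω).Lo = (st ends w a₁ a₂ a₃ w ω).Lb := rfl

open Classical in
/-- With `o = b = w` the two `o`-coordinates are the two `b`-coordinates. -/
lemma st_pair_Ho_eq_Hb (ω : Config E) :
    (st ends w a₁ a₂ a₃ w ω).Ho = (st ends w a₁ a₂ a₃ w ω).Hb := rfl

open Classical in
/-- A mark in both root clusters joins the roots. -/
lemma st_Lo_Ho_q' (ω : Config E) : (st ends w a₁ a₂ a₃ w ω).Lo = true →
    (st ends w a₁ a₂ a₃ w ω).Ho = true → (st ends w a₁ a₂ a₃ w ω).q' = true := by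
  unfold st St.Lo St.Ho St.q'
  simp only [decide_eq_true_eq]
  intro h1 h2
  exact conn_trans h2 (conn_symm h1)

open Classical in
/-- `a₃` in both root clusters joins the roots. -/
lemma st_L3_H3_q' (ω : Config E) : (st ends w a₁ a₂ a₃ w ω).L3 = true →
    (st ends w a₁ a₂ a₃ w ω).H3 = true → (st ends w a₁ a₂ a₃ w ω).q' = true := by
  unfold st St.L3 St.H3 St.q'
  simp only [decide_eq_true_eq]
  intro h1 h2
  exact conn_trans h2 (conn_symm h1)

end Pointwise

/-! ## Row 2′TRI on the pendant-pair instances -/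

section Nonneg

open Classical

variable {V : Type*} {E : Type*} [DecidableEq V] [Fintype E] [DecidableEq E] {R : Type*} [Field R]
  [LinearOrder R] [IsStrictOrderedRing R]

omit [DecidableEq V] in
/-- A typed count of a pointwise nonnegative kernel is nonnegative. -/
lemma typedCount_nonneg_of_pointwise (F : Finset E) (z : Config E) (τ : E → ℕ)
    {K : Config E → Config E → Config E → R} (hK : ∀ x y w, 0 ≤ K x y w) :
    0 ≤ typedCount F z τ K := by
  unfold typedCount
  refine Finset.sum_nonneg fun x _ => Finset.sum_nonneg fun y _ => Finset.sum_nonneg fun w _ => ?_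
  split_ifs
  · exact hK x y w
  · exact le_refl _

variable (ends : E → Sym2 V) (a₁ a₂ a₃ w : V)

omit [DecidableEq V] in
/-- **Row 2′TRI at a pendant pair**: if `o = b = w` is a leaf at a typed edge of class `1`, the
typed count of `K₃` is nonnegative, whatever the rest of the instance. -/
theorem typedCount_nonneg_of_pendant_pair_one {g : E} {v : V} (hg : ends g = s(w, v))
    (hleaf : ∀ e, w ∈ ends e → e = g) (hwv : w ≠ v) (hw1 : w ≠ a₁) (hw2 : w ≠ a₂)
    (hw3 : w ≠ a₃) (F : Finset E) (hgF : g ∈ F) (z : Config E) (τ : E → ℕ) (hτ : τ g = 1) :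
    0 ≤ typedCount F z τ (K3 ends w a₁ a₂ a₃ w : Config E → Config E → Config E → R) := by
  rw [typedCount_pendant_pair_one ends a₁ a₂ a₃ w hg hleaf hwv hw1 hw2 hw3 F hgF z τ hτ]
  refine typedCount_nonneg_of_pointwise _ _ _ fun x y w' => ?_
  exact_mod_cast KP_nonneg_pair _ _ _ (st_pair_Lo_eq_Lb ends a₁ a₂ a₃ w w')
    (st_pair_Ho_eq_Hb ends a₁ a₂ a₃ w w') (st_Lo_Ho_q' ends a₁ a₂ a₃ w w')
    (st_L3_H3_q' ends a₁ a₂ a₃ w w')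

variable (o b x : V)

/-- **Row 2′TRI on the census pair instances**: `o` a leaf at `b` by the typed edge `eob` of class
`≥ 1`, `b` carrying exactly the further edge `gp = {b, x}` of class `1`: the typed count of `K₃`
is nonnegative, whatever the rest of the instance. -/
theorem typedCount_nonneg_of_pendant_o_b {gp eob : E} (hgp : ends gp = s(b, x))
    (heob : ends eob = s(b, o)) (hleafo : ∀ e, o ∈ ends e → e = eob)
    (hedgeb : ∀ e, b ∈ ends e → e = gp ∨ e = eob)
    (h1b : a₁ ≠ b) (h1o : a₁ ≠ o) (h2b : a₂ ≠ b) (h2o : a₂ ≠ o) (h3b : a₃ ≠ b) (h3o : a₃ ≠ o)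
    (hbx : b ≠ x) (hob : o ≠ b) (hox : o ≠ x)
    (F : Finset E) (hgpF : gp ∈ F) (heobF : eob ∈ F) (z : Config E) (τ : E → ℕ)
    (hτp : τ gp = 1) (hτob : 1 ≤ τ eob) :
    0 ≤ typedCount F z τ (K3 ends o a₁ a₂ a₃ b : Config E → Config E → Config E → R) := by
  have hgpeob : gp ≠ eob := by
    intro h
    rw [h, heob, Sym2.eq_iff] at hgp
    rcases hgp with ⟨-, h1⟩ | ⟨h1, -⟩
    · exact hox h1
    · exact hbx h1
  -- the contraction of `eob` into `b`
  set W : Finset V := {b, o} with hW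
  have hmem : ∀ v : V, v ∈ W ↔ v = b ∨ v = o := fun v => by
    rw [hW, Finset.mem_insert, Finset.mem_singleton]
  have cmb : contractMap W b b = b := contractMap_of_mem ((hmem b).2 (Or.inl rfl))
  have cmo : contractMap W b o = b := contractMap_of_mem ((hmem o).2 (Or.inr rfl))
  have cmfix : ∀ v : V, v ≠ b → v ≠ o → contractMap W b v = v := fun v hv1 hv2 =>
    contractMap_of_notMem (fun h => by rcases (hmem v).1 h with h | h <;> contradiction)
  have cm1 := cmfix a₁ h1b h1o
  have cm2 := cmfix a₂ h2b h2o
  have cm3 := cmfix a₃ h3b h3o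
  have cmx := cmfix x hbx.symm hox.symm
  set ends' := contractEnds ends W b with hends'
  have hloop : ends' eob = s(b, b) := by
    rw [hends', contractEnds_apply, heob, Sym2.map_mk, cmb, cmo]
  have heobF' : eob ∉ F.erase eob := fun h => (Finset.mem_erase.1 h).1 rfl
  -- the support of the instance after the contraction
  set z' : Config E := Function.update z eob false with hz'
  set S : Finset E := F.erase eob ∪ Finset.univ.filter (fun e => z' e = true) with hS
  have hFS : F.erase eob ⊆ S := Finset.subset_union_left
  have hzS : ∀ e, e ∉ S → z' e = false := by
    intro e he
    by_contra h
    exact he (Finset.mem_union_right _ (Finset.mem_filter.2 ⟨Finset.mem_univ e,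
      by simpa using h⟩))
  have heobS : eob ∉ S := by
    intro h
    rcases Finset.mem_union.1 h with h | h
    · exact heobF' h
    · have := (Finset.mem_filter.1 h).2
      rw [hz', Function.update_self] at this
      exact Bool.false_ne_true this
  have hgpS : gp ∈ S := hFS (Finset.mem_erase.2 ⟨hgpeob, hgpF⟩)
  -- the reduction
  have heob' : ends eob = s(o, b) := by rw [heob, Sym2.eq_swap]
  rw [typedCount_pendant_o ends o a₁ a₂ a₃ b heob' hleafo hob h1o.symm h2o.symm h3o.symm hob F
    heobF z τ hτob]
  refine mul_nonneg (Nat.cast_nonneg _) ?_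
  rw [typedCount_type_three F eob heobF z _ (Function.update_self eob 3 τ),
    typedCount_contract_open ends o a₁ a₂ a₃ b heob (F.erase eob) heobF'
      (Function.update z eob true) (Function.update_self eob true z),
    cmo, cm1, cm2, cm3, cmb, ← hends',
    typedCount_pinned_loop ends' b a₁ a₂ a₃ b hloop (F.erase eob) heobF' _
      (Function.update_self eob true z), Function.update_idem, ← hz',
    typedCount_restrict S ends' b a₁ a₂ a₃ b hFS hzS]
  -- the restricted instance: the pair `b` is a leaf at `gp` of class `1`
  have hgp' : rEnds S ends' ⟨gp, hgpS⟩ = s(b, x) := by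
    show ends' gp = _
    rw [hends', contractEnds_apply, hgp, Sym2.map_mk, cmb, cmx]
  have hleafw' : ∀ e : S, b ∈ rEnds S ends' e → e = ⟨gp, hgpS⟩ := by
    intro e he
    change b ∈ ends' e.1 at he
    rw [hends', contractEnds_apply, Sym2.mem_map] at he
    obtain ⟨v, hv, hvb⟩ := he
    have hne : e.1 ≠ eob := fun h => heobS (h ▸ e.2)
    refine Subtype.ext ?_
    by_cases hvW : v ∈ W
    · rcases (hmem v).1 hvW with rfl | rfl
      · rcases hedgeb e.1 hv with h | h
        · exact h
        · exact absurd h hne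
      · exact absurd (hleafo e.1 hv) hne
    · rw [contractMap_of_notMem hvW] at hvb
      exact absurd ((hmem v).2 (Or.inl hvb)) hvW
  have hτ' : rτ S (Function.update τ eob 3) ⟨gp, hgpS⟩ = 1 := by
    show Function.update τ eob 3 gp = 1
    rw [Function.update_of_ne hgpeob]; exact hτp
  exact typedCount_nonneg_of_pendant_pair_one (rEnds S ends') a₁ a₂ a₃ b hgp' hleafw' hbx h1b.symm
    h2b.symm h3b.symm (rF S (F.erase eob)) (mem_rF.2 (Finset.mem_erase.2 ⟨hgpeob, hgpF⟩))
    (rConfig S z') (rτ S (Function.update τ eob 3)) hτ'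

end Nonneg

end TypedRed

end CovForm

end Summit.Ventures.PercRepro2
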